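import Literature.AlgebraicGeometry.Frobenioids.IsometricPreSteps
import HarnessLib

/-!
# Frobenioids I, Proposition 1.9 (iii): the functor `φ^*` on isometric pre-steps

Mochizuki, *The geometry of Frobenioids I: the general theory*, Kyushu J. Math. **62** (2008)
293–400, §1, Proposition 1.9 (iii) and its proof, kurims text pp. 31, 33
[cite: MochizukiFrdI2008, Prop. 1.9(iii)]. Standing data: `C → F_Φ` a Frobenioid (`hF`).

> "(iii) Any pull-back morphism `φ : A → B` of `C` induces a functor [well-defined up to
> isomorphism] `φ^* : C^imtr-pre_B → C^imtr-pre_A` that maps an isometric pre-step `δ : D → B`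
> to the unique [up to isomorphism] isometric pre-step `γ : C → A` that fits into a commutative
> diagram `γ ; φ` over `ψ ; δ` [i.e. `φ ∘ γ = δ ∘ ψ`], where `ψ` is the pull-back morphism that
> arises by applying the equivalence of categories of Definition 1.3, (i), (c), to the arrow
> `Base(δ)⁻¹ ∘ Base(φ)`, and `γ` is the morphism that arises from the isomorphism of functors
> appearing in the definition of a 'pull-back morphism' [cf. Definition 1.2, (ii)]."

PROVED ("Assertion (iii) follows formally from the definitions, together with the fact that
pull-back morphisms are linear isometries [cf. Proposition 1.4, (ii)], which implies
[cf. Remark 1.1.1] that `γ` is an isometric pre-step", p. 33).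

Renderings (recorded for the referee). As for (ii), `φ^*` is characterised by a property
(`IsPullbackAlong F φ Ψ`: `Ψ(δ) ≫ φ = ψ ≫ δ` for some pull-back morphism `ψ`; then automatically
`Base(ψ) = Base(Ψ δ) ∘ Base(φ) ∘ Base(δ)⁻¹`, i.e. `ψ` lies over `Base(δ)⁻¹ ∘ Base(φ)` up to the
identification `Base(Ψ δ)`); we prove existence, uniqueness of `γ` up to isomorphism over `A`,
and uniqueness of `Ψ` up to isomorphism. The general lemma `exists_isPullbackMorphism_over`
(a pull-back morphism into `B` over any given arrow `X₀ → B_D` of `D`) is the essential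
surjectivity in Def. 1.3 (i)(c). No statement of the paper is strengthened.
-/

namespace Literature.AlgebraicGeometry.Frobenioids

open CategoryTheory Opposite

universe w v v' u u'

namespace PreFrobenioid

variable {D : Type u} [Category.{v} D] {Φ : Dᵒᵖ ⥤ CommMonCat.{w}}
  {C : Type u'} [Category.{v'} C] (F : C ⥤ ElemFrobenioid Φ)

/-- `Ψ : C^imtr-pre_B → C^imtr-pre_A` *is a pull-back along* the pull-back morphism `φ : A → B`
if it sends every isometric pre-step `δ : Y → B` to an isometric pre-step `γ : X → A` fitting in a
commutative square `φ ∘ γ = δ ∘ ψ` with `ψ` a pull-back morphism (FrdI Prop. 1.9 (iii)).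
[cite: MochizukiFrdI2008, Prop. 1.9(iii) p.31] -/
def IsPullbackAlong {A B : C} (φ : A ⟶ B)
    (Ψ : Over (⟨B⟩ : ImtrPreCat F) ⥤ Over (⟨A⟩ : ImtrPreCat F)) : Prop :=
  ∀ V : Over (⟨B⟩ : ImtrPreCat F), ∃ ψ : (Ψ.obj V).left.obj ⟶ V.left.obj,
    IsPullbackMorphism F ψ ∧ (Ψ.obj V).hom.1 ≫ φ = ψ ≫ V.hom.1

variable {F}

/-! ### Pull-back morphisms over a given base arrow (Def. 1.3 (i)(c)) -/

/-- Essential surjectivity of `C^pl-bk_B → D_{B_D}` (Def. 1.3 (i)(c)), spelled out: every arrow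
`f : X₀ → B_D` of `D` is, up to an isomorphism `W_D ≅ X₀`, the projection of a pull-back morphism
`ψ : W → B`. [cite: MochizukiFrdI2008, Def. 1.3(i)] -/
theorem exists_isPullbackMorphism_over (hF : IsFrobenioid F) (B : C) {X₀ : D}
    (f : X₀ ⟶ baseObj F B) :
    ∃ (W : C) (ψ : W ⟶ B) (i : baseObj F W ≅ X₀), IsPullbackMorphism F ψ ∧
      Base F ψ = i.hom ≫ f := by
  haveI := hF.i_c B
  obtain ⟨P, ⟨e⟩⟩ := Functor.EssSurj.mem_essImage (pullbackSliceToBase F B) (Over.mk f)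
  exact ⟨P.left.obj, P.hom.1, (Over.forget _).mapIso e, P.hom.2, (Over.w e.hom).symm⟩

/-- The arrow provided by a pull-back morphism `φ : A → B` (Def. 1.2 (ii)): for `g : X → B` and
`b : X_D → A_D` with `Base(g) = Base(φ) ∘ b` there is a unique `γ : X → A` with `φ ∘ γ = g` and
`Base(γ) = b`. [cite: MochizukiFrdI2008, Def. 1.2(ii)] -/
theorem IsPullbackMorphism.exists_lift {A B X : C} {φ : A ⟶ B} (hφ : IsPullbackMorphism F φ)
    (g : X ⟶ B) (b : baseObj F X ⟶ baseObj F A) (hb : Base F g = b ≫ Base F φ) :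
    ∃ γ : X ⟶ A, γ ≫ φ = g ∧ Base F γ = b := by
  obtain ⟨γ, hγ⟩ := (hφ X).2 ⟨(g, b), hb⟩
  exact ⟨γ, congrArg (fun p : PullbackHomData F φ X => p.1.1) hγ,
    congrArg (fun p : PullbackHomData F φ X => p.1.2) hγ⟩

/-- The injectivity provided by a pull-back morphism `φ` (Def. 1.2 (ii)): arrows into its domain
are determined by their composites with `φ` and their projections to `D`.
[cite: MochizukiFrdI2008, Def. 1.2(ii)] -/
theorem IsPullbackMorphism.hom_ext {A B X : C} {φ : A ⟶ B} (hφ : IsPullbackMorphism F φ)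
    {γ γ' : X ⟶ A} (h₁ : γ ≫ φ = γ' ≫ φ) (h₂ : Base F γ = Base F γ') : γ = γ' :=
  (hφ X).1 (Subtype.ext (Prod.ext h₁ h₂))

/-! ### The square of Prop. 1.9 (iii) -/

/-- **Prop. 1.9 (iii)**, construction: for a pull-back morphism `φ : A → B` and an isometric
pre-step `δ : Y → B` there are a pull-back morphism `ψ : X → Y` [over `Base(δ)⁻¹ ∘ Base(φ)`,
Def. 1.3 (i)(c)] and an isometric pre-step `γ : X → A` [from the definition of a pull-back
morphism] with `φ ∘ γ = δ ∘ ψ`; `γ` is an isometric pre-step since pull-back morphisms are linear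
isometries (Prop. 1.4 (ii), Remark 1.1.1). [cite: MochizukiFrdI2008, Prop. 1.9(iii) p.31] -/
theorem exists_square_of_isPullbackMorphism (hF : IsFrobenioid F) {A B Y : C} {φ : A ⟶ B}
    (hφ : IsPullbackMorphism F φ) (δ : Y ⟶ B) (hδ : IsIsometricPreStep F δ) :
    ∃ (X : C) (γ : X ⟶ A) (ψ : X ⟶ Y), IsIsometricPreStep F γ ∧ IsPullbackMorphism F ψ ∧
      γ ≫ φ = ψ ≫ δ := by
  have hP : IsPreFrobenioid Φ F := hF.isPreFrobenioid
  haveI : IsIso (Base F δ) := hδ.2.2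
  obtain ⟨⟨hφco, hφiso⟩, hφlin⟩ := hF.iv_b φ hφ
  obtain ⟨X, ψ, i, hψ, hψb⟩ :=
    exists_isPullbackMorphism_over hF Y (Base F φ ≫ inv (Base F δ))
  obtain ⟨γ, hγ, hγb⟩ := hφ.exists_lift (ψ ≫ δ) i.hom (by
    rw [base_comp, hψb, Category.assoc, Category.assoc, IsIso.inv_hom_id, Category.comp_id])
  obtain ⟨⟨_, hψiso⟩, hψlin⟩ := hF.iv_b ψ hψ
  refine ⟨X, γ, ψ, ⟨?_, ?_, ?_⟩, hψ, hγ⟩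
  · -- isometric: `Div(γ ≫ φ) = Div γ` and `Div(ψ ≫ δ) = 0`
    have h1 : Div F (γ ≫ φ) = Div F γ := by
      rw [div_comp, show Div F φ = 1 from hφiso, map_one, one_mul, show degFr F φ = 1 from hφlin,
        PNat.one_coe, pow_one]
    have h2 : Div F (ψ ≫ δ) = 1 := by
      rw [div_comp, show Div F δ = 1 from hδ.1, map_one, one_mul, show Div F ψ = 1 from hψiso,
        one_pow]
    show Div F γ = 1
    rw [← h1, hγ, h2]
  · -- linear
    have h : IsLinear F (γ ≫ φ) := by rw [hγ]; exact IsLinear.comp F hψlin hδ.2.1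
    exact (isLinear_factors F h).2
  · -- base-isomorphism
    show IsIso (Base F γ)
    rw [hγb]
    infer_instance

/-- **Prop. 1.9 (iii)**, comparison of squares: given squares `φ ∘ γ = δ ∘ ψ`, `φ ∘ γ' = δ' ∘ ψ'`
as above and an arrow `m : δ → δ'` of `C^imtr-pre_B`, there is an arrow `n : X → X'` with
`γ' ∘ n = γ` (and `ψ' ∘ n = m ∘ ψ`); this gives the action of `φ^*` on arrows and, with `m = id`,
the uniqueness of `γ` up to isomorphism. [cite: MochizukiFrdI2008, Prop. 1.9(iii) p.31] -/
theorem exists_hom_of_squares {A B Y Y' X X' : C} {φ : A ⟶ B} (hφ : IsPullbackMorphism F φ)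
    {δ : Y ⟶ B} {δ' : Y' ⟶ B} (hδ' : IsIsometricPreStep F δ')
    {γ : X ⟶ A} {ψ : X ⟶ Y} {γ' : X' ⟶ A} {ψ' : X' ⟶ Y'}
    (hγ' : IsIsometricPreStep F γ') (hψ' : IsPullbackMorphism F ψ')
    (hsq : γ ≫ φ = ψ ≫ δ) (hsq' : γ' ≫ φ = ψ' ≫ δ') (m : Y ⟶ Y') (hm : m ≫ δ' = δ) :
    ∃ n : X ⟶ X', n ≫ γ' = γ ∧ n ≫ ψ' = ψ ≫ m := by
  haveI : IsIso (Base F δ') := hδ'.2.2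
  haveI : IsIso (Base F γ') := hγ'.2.2
  -- `Base ψ = Base γ ≫ Base φ ≫ (Base δ)⁻¹`, `Base ψ' = Base γ' ≫ Base φ ≫ (Base δ')⁻¹`
  have hb : Base F ψ ≫ Base F δ = Base F γ ≫ Base F φ := by rw [← base_comp, ← hsq, base_comp]
  have hb' : Base F ψ' ≫ Base F δ' = Base F γ' ≫ Base F φ := by rw [← base_comp, ← hsq', base_comp]
  have hmb : Base F m ≫ Base F δ' = Base F δ := by rw [← base_comp, hm]
  have key : Base F (ψ ≫ m) = (Base F γ ≫ inv (Base F γ')) ≫ Base F ψ' := by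
    rw [← cancel_mono (Base F δ'), base_comp, Category.assoc, hmb, hb, Category.assoc,
      Category.assoc, hb', IsIso.inv_hom_id_assoc]
  obtain ⟨n, hn, hnb⟩ := hψ'.exists_lift (ψ ≫ m) (Base F γ ≫ inv (Base F γ')) key
  refine ⟨n, hφ.hom_ext ?_ ?_, hn⟩
  · rw [Category.assoc, hsq', reassoc_of% hn, hm, hsq]
  · rw [base_comp, hnb, Category.assoc, IsIso.inv_hom_id, Category.comp_id]

/-- **Prop. 1.9 (iii)**, "the unique [up to isomorphism] isometric pre-step `γ`": two squares for
the same `δ` have isomorphic corners over `A`. [cite: MochizukiFrdI2008, Prop. 1.9(iii) p.31] -/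
theorem square_unique (hF : IsFrobenioid F) {A B Y X X' : C} {φ : A ⟶ B}
    (hφ : IsPullbackMorphism F φ) {δ : Y ⟶ B} (hδ : IsIsometricPreStep F δ)
    {γ : X ⟶ A} {ψ : X ⟶ Y} {γ' : X' ⟶ A} {ψ' : X' ⟶ Y} (hγ : IsIsometricPreStep F γ)
    (hψ : IsPullbackMorphism F ψ) (hγ' : IsIsometricPreStep F γ') (hψ' : IsPullbackMorphism F ψ')
    (hsq : γ ≫ φ = ψ ≫ δ) (hsq' : γ' ≫ φ = ψ' ≫ δ) : ∃ e : X ≅ X', e.hom ≫ γ' = γ := by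
  obtain ⟨n, hn, -⟩ := exists_hom_of_squares hφ hδ hγ' hψ' hsq hsq' (𝟙 Y) (Category.id_comp δ)
  obtain ⟨n', hn', -⟩ := exists_hom_of_squares hφ hδ hγ hψ hsq' hsq (𝟙 Y) (Category.id_comp δ)
  haveI := hF.v_a γ hγ.2
  haveI := hF.v_a γ' hγ'.2
  have h1 : n ≫ n' = 𝟙 X := by rw [← cancel_mono γ, Category.assoc, hn', hn, Category.id_comp]
  have h2 : n' ≫ n = 𝟙 X' := by rw [← cancel_mono γ', Category.assoc, hn, hn', Category.id_comp]
  exact ⟨⟨n, n', h1, h2⟩, hn⟩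

/-! ### Proposition 1.9 (iii): existence and uniqueness of `φ^*` -/

/-- A functor into a category with at most one arrow between any two objects is determined by
its object map and the existence of the required arrows. [cite: MochizukiFrdI2008, Prop. 1.9(iii) p.33] -/
private noncomputable def functorOfExistsHom' {P : Type*} [Category P] {Q : Type*} [Category Q]
    (hQ : ∀ X Y : Q, Subsingleton (X ⟶ Y)) (obj : P → Q)
    (h : ∀ ⦃X Y : P⦄, (X ⟶ Y) → Nonempty (obj X ⟶ obj Y)) : P ⥤ Q where
  obj := obj
  map f := (h f).some
  map_id X := by haveI := hQ (obj X) (obj X); exact Subsingleton.elim _ _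
  map_comp {X Y Z} _ _ := by haveI := hQ (obj X) (obj Z); exact Subsingleton.elim _ _

/-- **Prop. 1.9 (iii)**, existence: a pull-back morphism `φ : A → B` induces a functor
`φ^* : C^imtr-pre_B → C^imtr-pre_A`, `δ ↦ γ`. [cite: MochizukiFrdI2008, Prop. 1.9(iii) p.31] -/
theorem exists_pullbackFunctor (hF : IsFrobenioid F) {A B : C} (φ : A ⟶ B)
    (hφ : IsPullbackMorphism F φ) :
    ∃ Ψ : Over (⟨B⟩ : ImtrPreCat F) ⥤ Over (⟨A⟩ : ImtrPreCat F), IsPullbackAlong F φ Ψ := by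
  have hex : ∀ V : Over (⟨B⟩ : ImtrPreCat F), ∃ (X : C) (γ : X ⟶ A) (ψ : X ⟶ V.left.obj),
      IsIsometricPreStep F γ ∧ IsPullbackMorphism F ψ ∧ γ ≫ φ = ψ ≫ V.hom.1 :=
    fun V => exists_square_of_isPullbackMorphism hF hφ V.hom.1 V.hom.2
  choose X γ ψ hγ hψ hsq using hex
  let obj : Over (⟨B⟩ : ImtrPreCat F) → Over (⟨A⟩ : ImtrPreCat F) :=
    fun V => Over.mk (Y := (⟨X V⟩ : ImtrPreCat F)) ⟨γ V, hγ V⟩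
  have hhom : ∀ ⦃V V' : Over (⟨B⟩ : ImtrPreCat F)⦄, (V ⟶ V') → Nonempty (obj V ⟶ obj V') := by
    intro V V' m
    have hm : m.left.1 ≫ V'.hom.1 = V.hom.1 := congrArg InducedWideCategory.Hom.hom (Over.w m)
    obtain ⟨n, hn, -⟩ := exists_hom_of_squares hφ V'.hom.2 (hγ V') (hψ V') (hsq V) (hsq V')
      m.left.1 hm
    have hn' : IsIsometricPreStep F n :=
      IsIsometricPreStep.of_comp_right hF.isPreFrobenioid (g := γ V') (by rw [hn]; exact hγ V)
    exact ⟨Over.homMk ⟨n, hn'⟩ (InducedWideCategory.Hom.ext hn)⟩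
  exact ⟨functorOfExistsHom' (subsingleton_hom_over_imtrPre hF) obj hhom,
    fun V => ⟨ψ V, hψ V, hsq V⟩⟩

/-- **Prop. 1.9 (iii)**, "[well-defined up to isomorphism]": any two pull-backs along `φ` are
isomorphic functors. [cite: MochizukiFrdI2008, Prop. 1.9(iii) p.31] -/
theorem pullbackFunctor_unique (hF : IsFrobenioid F) {A B : C} {φ : A ⟶ B}
    (hφ : IsPullbackMorphism F φ)
    {Ψ Ψ' : Over (⟨B⟩ : ImtrPreCat F) ⥤ Over (⟨A⟩ : ImtrPreCat F)} (hΨ : IsPullbackAlong F φ Ψ)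
    (hΨ' : IsPullbackAlong F φ Ψ') : Nonempty (Ψ ≅ Ψ') := by
  have hP : IsPreFrobenioid Φ F := hF.isPreFrobenioid
  have hcomp : ∀ V, Nonempty (Ψ.obj V ≅ Ψ'.obj V) := by
    intro V
    obtain ⟨ψ, hψ, hsq⟩ := hΨ V
    obtain ⟨ψ', hψ', hsq'⟩ := hΨ' V
    obtain ⟨e, he⟩ := square_unique hF hφ V.hom.2 (Ψ.obj V).hom.2 hψ (Ψ'.obj V).hom.2 hψ' hsq hsq'
    exact ⟨Over.isoMk (isoMk e (isIsometricPreStep_of_isIso hP e.hom)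
      (isIsometricPreStep_of_isIso hP e.inv)) (InducedWideCategory.Hom.ext he)⟩
  haveI : ∀ X Y : Over (⟨A⟩ : ImtrPreCat F), Subsingleton (X ⟶ Y) :=
    subsingleton_hom_over_imtrPre hF
  exact ⟨NatIso.ofComponents (fun V => (hcomp V).some) (fun _ => Subsingleton.elim _ _)⟩

end PreFrobenioid

end Literature.AlgebraicGeometry.Frobenioids
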